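import Literature.AlgebraicGeometry.Motives.HodgeLieSemisimpleOfTotallyRealCentre
import Literature.AlgebraicGeometry.HodgeTheory.PicardNumberCentreBoundOfNoTypeIVFactor
import Literature.AlgebraicGeometry.HodgeTheory.RealMultiplicationHodgeGroupEqLefschetz
import HarnessLib

/-!
# No factor of type IV ⟹ the Hodge Lie algebra of `H¹(A(ℂ); ℚ)` has trivial centre («`Hg(X)` is semi-simple»,
# Moonen–Zarhin 1999 §1), and `H¹(A)` is `Θ`-rigid

Family `hodge`, layer `Literature/AlgebraicGeometry/HodgeTheory`; THEOREMS ONLY — no definition, no named fact, no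
`sorry` (D-0026, net debt 0). Lane `lit-hodgefound` (Track 2 foundations library), prover seat `lit-hodgefound-p21`,
generation 29, row g29-#9; the abelian-variety half of g29-#8 `Motives/HodgeLieCentreTrivialOfTotallyRealCentre`
(`hodgeLie_inf_endAlg_eq_bot_of_center_totallyReal`, `rigid_of_center_totallyReal`) and g29-#10
`Motives/HodgeLieSemisimpleOfTotallyRealCentre` (`isSemisimple_hodgeLie_of_center_totallyReal`), through the bridge of g29-#6
`PicardNumberCentreBoundOfNoTypeIVFactor` (`AbelianVariety.forall_center_endAlg_hodge_one_totallyReal_of_hasNoTypeIVFactor`: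
`HasNoTypeIVFactor A` ⟹ the centre of `End_{HS}(H¹(A(ℂ); ℚ))` is totally real, Riemann's theorem
`mem_endAlg_hodge_one_iff_exists_bettiRep`).

PUBLISHED STATEMENT. Moonen–Zarhin 1999 §1 (held `paper:arxiv-math_9901113` p0002 L134–136): «The Hodge group `Hg(X)` is
a torus if and only if `X` is of CM-type. If `X` has no factors of Type 4 then `Hg(X)` is semi-simple. (See [Mumford 1969],
§2 and [Tankeev/Hazama], Lemma 1.4.)» Deligne LNM 900 I Prop. 3.6 (the centre of the Mumford–Tate group). In the tree's
language (`Motives/HodgeLieRigidModuloCentre`, `HodgeLieRestrictDerivedSurjective`, `HodgeLieRigidDirectSum`): the centre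
`𝔷(𝔥) = 𝔥 ∩ End_{HS}` of `𝔥 = Lie Hg(H¹(A))` is `⊥`, which is the hypothesis `h𝔷` of `rigid_of_center_eq_bot` («e.g. `H¹`
of an abelian variety without factors of type IV») — discharged here.

MAIN RESULTS (all proved; `H¹(A) = BettiUniverse.hodge hHD isSmoothProjective_holds 1`):
* **`AbelianVariety.hodgeLie_inf_endAlg_hodge_one_eq_bot_of_hasNoTypeIVFactor`** — `HasNoTypeIVFactor A ⟹ 𝔥(H¹A) ∩ End_{HS}(H¹A) = 0`;
  `AbelianVariety.eq_zero_of_mem_hodgeLie_hodge_one_of_forall_commute_of_hasNoTypeIVFactor` (every central element of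
  `𝔥(H¹A)` is `0`); `AbelianVariety.hodgeLie_inf_endAlg_hodge_one_eq_bot_of_isTotallyReal_endField` (`End⁰(A)` a totally
  real field).
* **`AbelianVariety.isSemisimple_hodgeLie_hodge_one_of_hasNoTypeIVFactor`** — Moonen–Zarhin's sentence: `𝔥(H¹A)` is a
  semisimple Lie algebra (Mathlib `LieAlgebra.IsSemisimple ℚ` on every Lie subalgebra of `𝔤𝔩(H¹)` with carrier `𝔥(H¹A)`);
  `AbelianVariety.hodgeLie_hodge_one_eq_derived_of_hasNoTypeIVFactor` (`𝔥 = [𝔥, 𝔥]`),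
  `AbelianVariety.isKilling_hodgeLie_hodge_one_of_hasNoTypeIVFactor`.
* **`AbelianVariety.hodge_one_rigid_of_hasNoTypeIVFactor`** — `H¹(A)` is `Θ`-rigid: every bracket-closed rational
  `𝔞 ⊆ 𝔥(H¹A)` whose complex span contains a Hodge operator is `𝔥(H¹A)`.
* the same two at an arbitrary smooth-projective witness `hX : IsSmoothProjective n A.X` and the tree's records
  `exists_isReal_hodgeModel_holds`, `hodgePQ_independent_of_hodgeModel_holds` (the shape of the Mumford–Tate-rank ladder,
  cf. `mtRank_hodge_one_of_isTotallyReal'`): `AbelianVariety.hodgeLie_inf_endAlg_eq_bot_of_hasNoTypeIVFactor'`,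
  `AbelianVariety.isSemisimple_hodgeLie_of_hasNoTypeIVFactor'`, `AbelianVariety.rigid_of_hasNoTypeIVFactor'`.

## References

* [MoonenZarhin1999LowDim] B. Moonen, Yu. Zarhin, *Hodge classes on abelian varieties of low dimension*, Math. Ann. 315
  (1999), §1. [cite: MoonenZarhin1999LowDim, §1]
* [Deligne1982HodgeCycles] P. Deligne, *Hodge cycles on abelian varieties*, LNM 900 (1982), I §3 Prop. 3.6.
  [cite: Deligne1982HodgeCycles, I §3 Prop. 3.6]
* [DeligneMilne1982Tannakian] P. Deligne, J. Milne, *Tannakian categories*, LNM 900, §6 Thm. 6.20 (Riemann).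
  [cite: DeligneMilne1982Tannakian, §6 Thm. 6.20]
-/

noncomputable section

namespace Literature.AlgebraicGeometry.HodgeTheory

open CategoryTheory Module Polynomial NumberField
open Literature.AlgebraicGeometry.Motives
open Literature.AlgebraicGeometry.Motives.HodgeStructure
open Literature.AlgebraicGeometry.ComplexMultiplication
open Literature.AlgebraicTopology.SingularHomology

variable {A : AbelianVariety ℂ}

/-- `H¹(A(ℂ); ℚ)` is polarizable (Hodge–Riemann; tree `smoothProjective_hodgeStructure_isPolarizable_holds`).
[cite: DeligneMilne1982Tannakian, §6 Thm. 6.20] -/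
private theorem hodge_one_isPolarizable [Module.Finite ℚ (bettiCohomology A.X 1)] (hHD : exists_isReal_hodgeModel) :
    (BettiUniverse.hodge hHD (AbelianVariety.isSmoothProjective_holds (A := A)) 1).IsPolarizable :=
  smoothProjective_hodgeStructure_isPolarizable_holds (AbelianVariety.isSmoothProjective_holds (A := A))
    (BettiUniverse.realHodgeModel hHD (AbelianVariety.isSmoothProjective_holds (A := A)))
    (BettiUniverse.realHodgeModel_isHodgeSymmetric hHD (AbelianVariety.isSmoothProjective_holds (A := A))) 1

/-! ### §1 `HasNoTypeIVFactor A ⟹ 𝔷(𝔥(H¹ A)) = 0` -/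

/-- **NO FACTOR OF TYPE IV ⟹ THE HODGE LIE ALGEBRA OF `H¹(A(ℂ); ℚ)` HAS TRIVIAL CENTRE** (`𝔥 ∩ End_{HS} = 0`; «If `X` has no
factors of Type 4 then `Hg(X)` is semi-simple»): the centre of `End_{HS}(H¹A) ≅ End⁰(A)^{op}` is totally real (g29-#6), `H¹A`
is an effective polarizable Hodge structure of weight one (Hodge–Riemann), and g29-#8 applies.
[cite: MoonenZarhin1999LowDim, §1] [cite: Deligne1982HodgeCycles, I §3 Prop. 3.6] [cite: DeligneMilne1982Tannakian, §6 Thm. 6.20] -/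
theorem AbelianVariety.hodgeLie_inf_endAlg_hodge_one_eq_bot_of_hasNoTypeIVFactor [HodgeTensorFacts.{0, 0}]
    [Module.Finite ℚ (bettiCohomology A.X 1)] (hHD : exists_isReal_hodgeModel) (hI : hodgePQ_independent_of_hodgeModel)
    (hIV : HasNoTypeIVFactor A) :
    (BettiUniverse.hodge hHD (AbelianVariety.isSmoothProjective_holds (A := A)) 1).hodgeLie ⊓
      Subalgebra.toSubmodule (BettiUniverse.hodge hHD (AbelianVariety.isSmoothProjective_holds (A := A)) 1).endAlg = ⊥ := by
  obtain ⟨ψ⟩ := hodge_one_isPolarizable (A := A) hHD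
  exact hodgeLie_inf_endAlg_eq_bot_of_center_totallyReal Nat.cast_one
    (HodgeModel.isEffective_hodgeStructure _ (AbelianVariety.isSmoothProjective_holds (A := A)) _ 1) ψ
    (AbelianVariety.forall_center_endAlg_hodge_one_totallyReal_of_hasNoTypeIVFactor hHD hI hIV)

/-- … literally: **every central element of `𝔥 = Lie Hg(H¹(A))` is zero** when `A` has no factor of type IV.
[cite: MoonenZarhin1999LowDim, §1] [cite: Deligne1982HodgeCycles, I §3 Prop. 3.6] -/
theorem AbelianVariety.eq_zero_of_mem_hodgeLie_hodge_one_of_forall_commute_of_hasNoTypeIVFactor [HodgeTensorFacts.{0, 0}]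
    [Module.Finite ℚ (bettiCohomology A.X 1)] (hHD : exists_isReal_hodgeModel) (hI : hodgePQ_independent_of_hodgeModel)
    (hIV : HasNoTypeIVFactor A) {z : Module.End ℚ (bettiCohomology A.X 1)}
    (hz : z ∈ (BettiUniverse.hodge hHD (AbelianVariety.isSmoothProjective_holds (A := A)) 1).hodgeLie)
    (hc : ∀ X ∈ (BettiUniverse.hodge hHD (AbelianVariety.isSmoothProjective_holds (A := A)) 1).hodgeLie, z * X = X * z) :
    z = 0 := by
  obtain ⟨ψ⟩ := hodge_one_isPolarizable (A := A) hHD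
  exact eq_zero_of_mem_hodgeLie_of_forall_commute_of_center_totallyReal Nat.cast_one
    (HodgeModel.isEffective_hodgeStructure _ (AbelianVariety.isSmoothProjective_holds (A := A)) _ 1) ψ
    (AbelianVariety.forall_center_endAlg_hodge_one_totallyReal_of_hasNoTypeIVFactor hHD hI hIV) hz hc

/-- **`End⁰(A)` a totally real field (real multiplication) ⟹ `𝔷(𝔥(H¹ A)) = 0`** (tree `hasNoTypeIVFactor_of_isTotallyReal`).
[cite: MoonenZarhin1999LowDim, §1 and §2 (2.2)] [cite: Deligne1982HodgeCycles, I §3 Prop. 3.6] -/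
theorem AbelianVariety.hodgeLie_inf_endAlg_hodge_one_eq_bot_of_isTotallyReal_endField [HodgeTensorFacts.{0, 0}]
    [Module.Finite ℚ (bettiCohomology A.X 1)] (hHD : exists_isReal_hodgeModel) (hI : hodgePQ_independent_of_hodgeModel)
    (hF : IsField A.endAlgebra) [IsTotallyReal (EndField A hF)] :
    (BettiUniverse.hodge hHD (AbelianVariety.isSmoothProjective_holds (A := A)) 1).hodgeLie ⊓
      Subalgebra.toSubmodule (BettiUniverse.hodge hHD (AbelianVariety.isSmoothProjective_holds (A := A)) 1).endAlg = ⊥ :=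
  AbelianVariety.hodgeLie_inf_endAlg_hodge_one_eq_bot_of_hasNoTypeIVFactor hHD hI
    (HodgeTheory.hasNoTypeIVFactor_of_isTotallyReal A hF)

/-! ### §1b `HasNoTypeIVFactor A ⟹ 𝔥(H¹ A) = [𝔥, 𝔥]` is semisimple -/

/-- **No factor of type IV ⟹ `𝔥(H¹ A) = [𝔥(H¹ A), 𝔥(H¹ A)]`** (`𝔥` reductive with trivial centre; g29-#10
`hodgeLie_eq_derived_of_center_totallyReal`). [cite: MoonenZarhin1999LowDim, §1] [cite: Deligne1982HodgeCycles, I §3 Prop. 3.6] -/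
theorem AbelianVariety.hodgeLie_hodge_one_eq_derived_of_hasNoTypeIVFactor [HodgeTensorFacts.{0, 0}]
    [Module.Finite ℚ (bettiCohomology A.X 1)] (hHD : exists_isReal_hodgeModel) (hI : hodgePQ_independent_of_hodgeModel)
    (hIV : HasNoTypeIVFactor A) :
    Submodule.span ℚ {B | ∃ X ∈ (BettiUniverse.hodge hHD (AbelianVariety.isSmoothProjective_holds (A := A)) 1).hodgeLie,
        ∃ Y ∈ (BettiUniverse.hodge hHD (AbelianVariety.isSmoothProjective_holds (A := A)) 1).hodgeLie, X * Y - Y * X = B} =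
      (BettiUniverse.hodge hHD (AbelianVariety.isSmoothProjective_holds (A := A)) 1).hodgeLie := by
  obtain ⟨ψ⟩ := hodge_one_isPolarizable (A := A) hHD
  exact hodgeLie_eq_derived_of_center_totallyReal Nat.cast_one
    (HodgeModel.isEffective_hodgeStructure _ (AbelianVariety.isSmoothProjective_holds (A := A)) _ 1) ψ
    (AbelianVariety.forall_center_endAlg_hodge_one_totallyReal_of_hasNoTypeIVFactor hHD hI hIV)

/-- **«IF `X` HAS NO FACTORS OF TYPE 4 THEN `Hg(X)` IS SEMI-SIMPLE»** (Moonen–Zarhin 1999 §1) for a complex abelian variety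
`A`: the Hodge Lie algebra `𝔥(H¹(A(ℂ); ℚ)) = Lie Hg(A)` is semisimple (Mathlib `LieAlgebra.IsSemisimple ℚ`, on every Lie
subalgebra of `𝔤𝔩(H¹)` with carrier `𝔥(H¹A)`; one exists, g29-#10 `exists_lieSubalgebra_toSubmodule_eq_hodgeLie`).
[cite: MoonenZarhin1999LowDim, §1] [cite: Deligne1982HodgeCycles, I §3 Prop. 3.6] -/
theorem AbelianVariety.isSemisimple_hodgeLie_hodge_one_of_hasNoTypeIVFactor [HodgeTensorFacts.{0, 0}]
    [Module.Finite ℚ (bettiCohomology A.X 1)] (hHD : exists_isReal_hodgeModel) (hI : hodgePQ_independent_of_hodgeModel)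
    (hIV : HasNoTypeIVFactor A) :
    letI : LieRing (Module.End ℚ (bettiCohomology A.X 1)) := LieRing.ofAssociativeRing
    ∀ 𝔏 : LieSubalgebra ℚ (Module.End ℚ (bettiCohomology A.X 1)),
      𝔏.toSubmodule = (BettiUniverse.hodge hHD (AbelianVariety.isSmoothProjective_holds (A := A)) 1).hodgeLie →
      LieAlgebra.IsSemisimple ℚ 𝔏 := by
  obtain ⟨ψ⟩ := hodge_one_isPolarizable (A := A) hHD
  exact isSemisimple_hodgeLie_of_center_totallyReal Nat.cast_one
    (HodgeModel.isEffective_hodgeStructure _ (AbelianVariety.isSmoothProjective_holds (A := A)) _ 1) ψ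
    (AbelianVariety.forall_center_endAlg_hodge_one_totallyReal_of_hasNoTypeIVFactor hHD hI hIV)

/-- … with non-degenerate Killing form. [cite: MoonenZarhin1999LowDim, §1] [cite: Deligne1982HodgeCycles, I §3 Prop. 3.6] -/
theorem AbelianVariety.isKilling_hodgeLie_hodge_one_of_hasNoTypeIVFactor [HodgeTensorFacts.{0, 0}]
    [Module.Finite ℚ (bettiCohomology A.X 1)] (hHD : exists_isReal_hodgeModel) (hI : hodgePQ_independent_of_hodgeModel)
    (hIV : HasNoTypeIVFactor A) :
    letI : LieRing (Module.End ℚ (bettiCohomology A.X 1)) := LieRing.ofAssociativeRing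
    ∀ 𝔏 : LieSubalgebra ℚ (Module.End ℚ (bettiCohomology A.X 1)),
      𝔏.toSubmodule = (BettiUniverse.hodge hHD (AbelianVariety.isSmoothProjective_holds (A := A)) 1).hodgeLie →
      LieAlgebra.IsKilling ℚ 𝔏 := by
  obtain ⟨ψ⟩ := hodge_one_isPolarizable (A := A) hHD
  exact isKilling_hodgeLie_of_center_totallyReal Nat.cast_one
    (HodgeModel.isEffective_hodgeStructure _ (AbelianVariety.isSmoothProjective_holds (A := A)) _ 1) ψ
    (AbelianVariety.forall_center_endAlg_hodge_one_totallyReal_of_hasNoTypeIVFactor hHD hI hIV)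

/-! ### §2 `Θ`-rigidity of `H¹(A)` -/

/-- **NO FACTOR OF TYPE IV ⟹ `H¹(A(ℂ); ℚ)` IS `Θ`-RIGID**: every bracket-closed rational subspace `𝔞 ⊆ 𝔥(H¹A)` whose
complex span contains an operator acting by `2p - 1` on `H^{p,1-p}` is all of `𝔥(H¹A)` (tree `rigid_of_center_eq_bot` at §1).
[cite: MoonenZarhin1999LowDim, §1 and §3 (3.1)] [cite: Deligne1982HodgeCycles, I §3 Prop. 3.6] -/
theorem AbelianVariety.hodge_one_rigid_of_hasNoTypeIVFactor [HodgeTensorFacts.{0, 0}]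
    [Module.Finite ℚ (bettiCohomology A.X 1)] (hHD : exists_isReal_hodgeModel) (hI : hodgePQ_independent_of_hodgeModel)
    (hIV : HasNoTypeIVFactor A) :
    ∀ 𝔞 : Submodule ℚ (Module.End ℚ (bettiCohomology A.X 1)),
      𝔞 ≤ (BettiUniverse.hodge hHD (AbelianVariety.isSmoothProjective_holds (A := A)) 1).hodgeLie →
      (∀ X ∈ 𝔞, ∀ Y ∈ 𝔞, X * Y - Y * X ∈ 𝔞) →
      (∃ Θ ∈ Submodule.span ℂ
          ((fun X : Module.End ℚ (bettiCohomology A.X 1) => X.baseChange ℂ) '' (𝔞 : Set (Module.End ℚ _))),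
        ∀ p, ∀ x ∈ (BettiUniverse.hodge hHD (AbelianVariety.isSmoothProjective_holds (A := A)) 1).piece p
          (((1 : ℕ) : ℤ) - p), Θ x = ((2 * p - ((1 : ℕ) : ℤ) : ℤ) : ℂ) • x) →
      (BettiUniverse.hodge hHD (AbelianVariety.isSmoothProjective_holds (A := A)) 1).hodgeLie ≤ 𝔞 :=
  rigid_of_center_eq_bot _ (hodge_one_isPolarizable (A := A) hHD)
    (AbelianVariety.hodgeLie_inf_endAlg_hodge_one_eq_bot_of_hasNoTypeIVFactor hHD hI hIV)

/-! ### §3 The same at an arbitrary smooth-projective witness and the tree's Hodge-decomposition records -/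

/-- **`HasNoTypeIVFactor A ⟹ 𝔷(𝔥(H¹ A)) = 0`** for any witness `hX : IsSmoothProjective n A.X`, with the tree's records
`exists_isReal_hodgeModel_holds`, `hodgePQ_independent_of_hodgeModel_holds` (the shape of the Mumford–Tate-rank ladder).
[cite: MoonenZarhin1999LowDim, §1] [cite: Deligne1982HodgeCycles, I §3 Prop. 3.6] -/
theorem AbelianVariety.hodgeLie_inf_endAlg_eq_bot_of_hasNoTypeIVFactor' [HodgeTensorFacts.{0, 0}] {n : ℕ}
    (hX : IsSmoothProjective n A.X) (hIV : HasNoTypeIVFactor A) :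
    haveI := BettiUniverse.finite hX 1
    (BettiUniverse.hodge exists_isReal_hodgeModel_holds hX 1).hodgeLie ⊓
      Subalgebra.toSubmodule (BettiUniverse.hodge exists_isReal_hodgeModel_holds hX 1).endAlg = ⊥ := by
  have hn : A.dim = n := schemeDim_eq_holds hX
  subst hn
  haveI := BettiUniverse.finite hX 1
  exact AbelianVariety.hodgeLie_inf_endAlg_hodge_one_eq_bot_of_hasNoTypeIVFactor exists_isReal_hodgeModel_holds
    hodgePQ_independent_of_hodgeModel_holds hIV

/-- **`HasNoTypeIVFactor A ⟹ 𝔥(H¹ A)` is semisimple**, at any witness `hX : IsSmoothProjective n A.X` and the tree's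
records. [cite: MoonenZarhin1999LowDim, §1] [cite: Deligne1982HodgeCycles, I §3 Prop. 3.6] -/
theorem AbelianVariety.isSemisimple_hodgeLie_of_hasNoTypeIVFactor' [HodgeTensorFacts.{0, 0}] {n : ℕ}
    (hX : IsSmoothProjective n A.X) (hIV : HasNoTypeIVFactor A) :
    haveI := BettiUniverse.finite hX 1
    letI : LieRing (Module.End ℚ (bettiCohomology A.X 1)) := LieRing.ofAssociativeRing
    ∀ 𝔏 : LieSubalgebra ℚ (Module.End ℚ (bettiCohomology A.X 1)),
      𝔏.toSubmodule = (BettiUniverse.hodge exists_isReal_hodgeModel_holds hX 1).hodgeLie → LieAlgebra.IsSemisimple ℚ 𝔏 := by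
  have hn : A.dim = n := schemeDim_eq_holds hX
  subst hn
  haveI := BettiUniverse.finite hX 1
  exact AbelianVariety.isSemisimple_hodgeLie_hodge_one_of_hasNoTypeIVFactor exists_isReal_hodgeModel_holds
    hodgePQ_independent_of_hodgeModel_holds hIV

/-- **`HasNoTypeIVFactor A ⟹ H¹(A)` is `Θ`-rigid**, at any witness `hX : IsSmoothProjective n A.X` and the tree's records.
[cite: MoonenZarhin1999LowDim, §1 and §3 (3.1)] [cite: Deligne1982HodgeCycles, I §3 Prop. 3.6] -/
theorem AbelianVariety.rigid_of_hasNoTypeIVFactor' [HodgeTensorFacts.{0, 0}] {n : ℕ} (hX : IsSmoothProjective n A.X)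
    (hIV : HasNoTypeIVFactor A) :
    haveI := BettiUniverse.finite hX 1
    ∀ 𝔞 : Submodule ℚ (Module.End ℚ (bettiCohomology A.X 1)),
      𝔞 ≤ (BettiUniverse.hodge exists_isReal_hodgeModel_holds hX 1).hodgeLie →
      (∀ X ∈ 𝔞, ∀ Y ∈ 𝔞, X * Y - Y * X ∈ 𝔞) →
      (∃ Θ ∈ Submodule.span ℂ
          ((fun X : Module.End ℚ (bettiCohomology A.X 1) => X.baseChange ℂ) '' (𝔞 : Set (Module.End ℚ _))),
        ∀ p, ∀ x ∈ (BettiUniverse.hodge exists_isReal_hodgeModel_holds hX 1).piece p (((1 : ℕ) : ℤ) - p),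
          Θ x = ((2 * p - ((1 : ℕ) : ℤ) : ℤ) : ℂ) • x) →
      (BettiUniverse.hodge exists_isReal_hodgeModel_holds hX 1).hodgeLie ≤ 𝔞 := by
  have hn : A.dim = n := schemeDim_eq_holds hX
  subst hn
  haveI := BettiUniverse.finite hX 1
  exact AbelianVariety.hodge_one_rigid_of_hasNoTypeIVFactor exists_isReal_hodgeModel_holds
    hodgePQ_independent_of_hodgeModel_holds hIV

end Literature.AlgebraicGeometry.HodgeTheory
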